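import Summits.ResolutionOfSingularities.ResolutionOfSingularities.Theorems.HomologicalConductorPersistenceDimOne
import HarnessLib

/-!
# Route `HomologicalConductor`, support item `PersistenceDimOne` (stmt-ResolutionOfSingularities-20102)

Rung S-1 of crux `Persistence` (chain W4.4b): the crux VERBATIM under the extra hypothesis
`ringKrullDim ↥A ≤ 1`. The item's signature is, character for character, the type of the landed
theorem `PersistenceDimOne.persistence_of_ringKrullDim_le_one`
(`Theorems/HomologicalConductorPersistenceDimOne.lean`, p461490): every stage `T_(m+1)` is a regular
local ring in dimension `≤ 1`, so `ca (T_(m+1)) = T_(m+1) ⊇ T_m ⊇ ca (T_m)`. This file only names the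
route decl. `[OURS · L1 w44b]`; not a statement of any manuscript.
-/

noncomputable section

-- single-problem summit: the doubled namespace component is forced
set_option linter.dupNamespace false

namespace Summit.ResolutionOfSingularities.ResolutionOfSingularities.Theorems

open Summit.ResolutionOfSingularities.ResolutionOfSingularities.Theses.HomologicalConductor

/-- **Support item `PersistenceDimOne` of route `HomologicalConductor`** (rung S-1 of the crux
`Persistence`): along the canonical normalised `ca`-tower of a finitely generated
`A ⊆ O ⊆ K = Frac A` of Krull dimension `≤ 1`, `ca (T_m) ⊆ ca (T_(m+1))` for every `m`
(every `T_(m+1)` is regular: stationary after a regular stage, Krull–Akizuki after a singular one).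
[cite: Matsumura1987, Thm. 11.7] -/
theorem persistenceDimOne_proof : PersistenceDimOne :=
  HomologicalConductor.PersistenceDimOne.persistence_of_ringKrullDim_le_one

end Summit.ResolutionOfSingularities.ResolutionOfSingularities.Theorems

end
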